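import Mathlib
import HarnessLib
import Literature.NumberTheory.Automorphic.AutomorphicRepInfinitesimalCharacter
import Summits.Langlands.Langlands.Theorems.BaseFieldAscentReciprocityTRCMStubQuadraticDescentLAlgebraic

/-!
# `ReciprocityTRCM` (route BaseFieldAscent, crux stmt-Langlands-1093), line `pieces`:
# the infinity-type conjunct of stub `stub_archimedeanDescentFacts` is a THEOREM where the line uses it

Stub F2 of the skeleton bundles two archimedean named facts:
(C1) `ArthurClozel1989_strongLifting_archimedean` (Arthur–Clozel 1989, Ch. 3 Thm. 5.1 with Ch. 1 §7;
a `def … : Prop` with no discharge in the tree) and (C2) the universal closure of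
`AutomorphicRepData.exists_hasInfinityType` (Clozel 1990, §3.3: every automorphic representation of
`GL_n(𝔸_K)` has a well-formed infinity type).  The line consumes (C2) only through the landed stub
5A1 (`stub_quadraticDescentLAlgebraic`), which applies it to the DESCENDED cuspidal `π` over the base
`F` of the CM quadratic `E/F` — and in the line `F` is totally real.

Over a totally real field (C2) is a theorem of the tree's model, proved here
(`exists_hasInfinityType_of_isTotallyReal`): every Borel–Jacquet datum `π = W / W'` has an
archimedean (Harish-Chandra) parameter `χ` (`AutomorphicRepData.exists_hasArchParameter_gl`: Schur's
lemma through `Z(𝔤)`-finiteness, and "characters of `Z(𝔤) ⊗ ℂ ≅ ℂ[x]^{𝔖ₙ}` are point evaluations",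
Harish-Chandra's theorem, all proved in `AutomorphicRepInfinitesimalCharacter` /
`HarishChandraGLParameterOfCharacter`), and when every complex embedding `σ` of `K` is real
(`σ̄ = σ`) the diagonal infinity type `σ ↦ {(x, x) : x ∈ χ σ}` is well formed (`n` weights, `swap`-stable,
`a - b = 0 ∈ ℤ`) with `a`-parts `χ`.  The remaining content of (C2) — an INTEGRAL pairing
`a_i - b_{p(i)} ∈ ℤ` between `χ σ_w` and `χ σ̄_w` at a COMPLEX place `w` (Zhelobenko / Langlands
classification for `GL_n(ℂ)`) — is never used by the line.

Consequently the narrowed hypothesis `forall_exists_hasInfinityType_of_isTotallyReal` (the shape of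
5A1's third hypothesis, restricted to totally real fields) holds outright, and 5A1 with its third
hypothesis so discharged is `quadraticDescentLAlgebraic_of_isTotallyReal` (same proof as 5A1:
Arthur–Clozel cyclic descent `cuspidal_descent_cyclic` and the archimedean clause of strong lifting,
both hypotheses, then `ArthurClozel1989_strongLifting_archimedean.isLAlgebraic_descent'`).

References: L. Clozel, *Motifs et formes automorphes* (1990), §3.3; A. Borel, H. Jacquet, Corvallis
1979, 4.6; A. W. Knapp, *Lie Groups Beyond an Introduction* (2002), Thm. 5.44; J. Arthur, L. Clozel,
Ann. of Math. Stud. 120 (1989), Ch. 3 Thm. 4.2 (d), Thm. 5.1.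
-/

noncomputable section

set_option linter.dupNamespace false -- project-wide option; `Summit.Langlands.Langlands` is the mandated namespace

open scoped NumberField Classical
open NumberField Literature.NumberTheory.Automorphic

namespace Summit.Langlands.Langlands.Theorems.ReciprocityTRCM

/-- **An archimedean parameter on `GL_n` has `n` entries at every complex embedding**: `σ` is
`σ_w` or `σ̄_w` for its place `w = mk σ`, and Harish-Chandra parameters of `𝔤𝔩ₙ(K_w)`-modules have
`n` entries (`card_eq_of_hasHCParameter`). Clozel 1990, §3.3. [cite: Clozel1990, §3.3] -/
theorem card_eq_of_hasArchParameter {n : ℕ} {K : Type} [Field K] [NumberField K]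
    {hK : isCompact_glFiniteIntegralLevel n K} {π : AutomorphicRepData (AutomorphyDatum.gl n K hK)}
    {χ : (K →+* ℂ) → Multiset ℂ} (h : π.HasArchParameter χ) (σ : K →+* ℂ) :
    Multiset.card (χ σ) = n := by
  -- adapted from `card_eq_of_hasArchParameter'` of `Literature/NumberTheory/Automorphic/AsaiSignArchParityCentre.lean`
  obtain ⟨ρ, -, hre, hco⟩ := h
  rcases (InfinitePlace.mk σ).isReal_or_isComplex with hw | hw
  · have h1 := (hre ⟨InfinitePlace.mk σ, hw⟩).1 (Algebra.ofId ℝ ℂ)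
    dsimp only at h1
    rwa [InfinitePlace.embedding_mk_eq_of_isReal (InfinitePlace.isReal_mk_iff.mp hw)] at h1
  · rcases InfinitePlace.mk_eq_iff.mp (InfinitePlace.mk_embedding (InfinitePlace.mk σ)) with hσ | hσ
    · have h1 := (hco ⟨InfinitePlace.mk σ, hw⟩).1 (AlgHom.id ℝ ℂ)
      dsimp only at h1
      rwa [algHomId_toRingHom_comp, hσ] at h1
    · have h1 := (hco ⟨InfinitePlace.mk σ, hw⟩).1 (Complex.conjAe : ℂ →ₐ[ℝ] ℂ)
      dsimp only at h1
      rwa [conjAe_toRingHom_comp, hσ] at h1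

/-- **The diagonal infinity type at conjugation-fixed embeddings.** If every complex embedding of
`K` is real (`σ̄ = σ`), an automorphic `π` on `GL_n(𝔸_K)` with archimedean parameter `χ` has the
well-formed infinity type `σ ↦ {(x, x) : x ∈ χ σ}`: `exists_hasInfinityType` carries no pairing
information at real places. Clozel 1990, §3.3. [cite: Clozel1990, §3.3] -/
theorem exists_hasInfinityType_of_conjugate_eq {n : ℕ} {K : Type} [Field K] [NumberField K]
    {hK : isCompact_glFiniteIntegralLevel n K}
    (hreal : ∀ σ : K →+* ℂ, ComplexEmbedding.conjugate σ = σ)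
    {π : AutomorphicRepData (AutomorphyDatum.gl n K hK)} {χ : (K →+* ℂ) → Multiset ℂ}
    (h : π.HasArchParameter χ) : π.exists_hasInfinityType := by
  -- adapted from `RegularTwistCM.Negative.exists_hasInfinityType_of_conjugate_eq`
  -- (`Summits/Langlands/Langlands/Theorems/RegularTwistCM/Negative/AdjointShapeCertificates.lean`)
  refine ⟨fun σ => (χ σ).map (fun x => (⟨x, x, 0, by simp⟩ : ArchWeight)),
    ⟨fun σ => ?_, fun σ => ?_⟩, ?_⟩
  · rw [Multiset.card_map]
    exact card_eq_of_hasArchParameter h σ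
  · rw [hreal σ, Multiset.map_map]
    rfl
  · have hfun : (fun σ => ((χ σ).map (fun x => (⟨x, x, 0, by simp⟩ : ArchWeight))).map
        ArchWeight.a) = χ := by
      funext σ
      rw [Multiset.map_map]
      conv_rhs => rw [← Multiset.map_id (χ σ)]
      rfl
    rw [hfun]
    exact h

/-- **Clozel's existence of an infinity type over a TOTALLY REAL field, unconditionally**: every
automorphic representation datum `π = W / W'` of `GL_n(𝔸_K)`, `K` totally real, has a well-formed
infinity type (the named fact `AutomorphicRepData.exists_hasInfinityType` for such `K`, every `n`,
every datum, no cuspidality).  `π` has an archimedean parameter (`exists_hasArchParameter_gl`: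
Schur's lemma for `W / W'` and Harish-Chandra's theorem, proved in the tree) and all embeddings of
`K` are real, so the diagonal type serves. Clozel 1990, §3.3; Borel–Jacquet 1979, 4.6; Knapp 2002,
Thm. 5.44. [cite: Clozel1990, §3.3] -/
theorem exists_hasInfinityType_of_isTotallyReal {n : ℕ} {K : Type} [Field K] [NumberField K]
    [IsTotallyReal K] {hK : isCompact_glFiniteIntegralLevel n K}
    (π : AutomorphicRepData (AutomorphyDatum.gl n K hK)) : π.exists_hasInfinityType := by
  obtain ⟨χ, hχ⟩ := π.exists_hasArchParameter_gl
  refine exists_hasInfinityType_of_conjugate_eq (fun σ => ?_) hχ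
  exact ComplexEmbedding.isReal_iff.mp
    (InfinitePlace.isReal_mk_iff.mp (IsTotallyReal.isReal (InfinitePlace.mk σ)))

/-- **The infinity-type conjunct of stub F2, NARROWED to totally real fields, holds outright** (in
the binder convention of the skeleton and of 5A1's third hypothesis): for every `n`, every totally
real `K`, every level fact `hK` and every datum `π` on `GL_n(𝔸_K)`, `π.exists_hasInfinityType`.
Clozel 1990, §3.3. [cite: Clozel1990, §3.3] -/
theorem forall_exists_hasInfinityType_of_isTotallyReal : ∀ (n : ℕ) (K : Type) [Field K] [NumberField K], NumberField.IsTotallyReal K → ∀ (hK : Literature.NumberTheory.Automorphic.isCompact_glFiniteIntegralLevel n K) (π : Literature.NumberTheory.Automorphic.AutomorphicRepData (Literature.NumberTheory.Automorphic.AutomorphyDatum.gl n K hK)), π.exists_hasInfinityType := by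
  intro n K _ _ hTR hK π
  exact exists_hasInfinityType_of_isTotallyReal π

/-- **L-algebraic quadratic descent over a TOTALLY REAL base, with Clozel's infinity types
discharged** (the landed 5A1 `stub_quadraticDescentLAlgebraic` minus its third hypothesis, plus
`IsTotallyReal F`): for `E/F` Galois quadratic over a totally real `F` and a cuspidal L-algebraic `P`
on `GL_n(𝔸_E)` with `Gal(E/F)`-stable Satake data there is an L-algebraic cuspidal `π` on
`GL_n(𝔸_F)` of which `P` is a weak base change lift — granted Arthur–Clozel's cyclic descent
(Ch. 3 Thm. 4.2 (d), `cuspidal_descent_cyclic`) and the archimedean clause of strong lifting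
(Thm. 5.1, `ArthurClozel1989_strongLifting_archimedean`) as hypotheses; the infinity type of the
descended `π` is `exists_hasInfinityType_of_isTotallyReal`.
[cite: ArthurClozelAMS120, Ch. 3 Thm. 4.2 (d) and Thm. 5.1] [cite: Clozel1990, §3.3] -/
theorem quadraticDescentLAlgebraic_of_isTotallyReal : Literature.NumberTheory.Automorphic.cuspidal_descent_cyclic → Literature.NumberTheory.Automorphic.ArthurClozel1989_strongLifting_archimedean → ∀ (n : ℕ) (F E : Type) [Field F] [NumberField F] [Field E] [NumberField E] [Algebra F E] [IsGalois F E], NumberField.IsTotallyReal F → Module.finrank F E = 2 → ∀ (hF : Literature.NumberTheory.Automorphic.isCompact_glFiniteIntegralLevel n F) (hE : Literature.NumberTheory.Automorphic.isCompact_glFiniteIntegralLevel n E) (P : Literature.NumberTheory.Automorphic.CuspidalAutomorphicRepData n E hE), P.1.IsLAlgebraic → Literature.NumberTheory.Automorphic.IsGaloisStableSatakeAE F P.1 → ∃ π : Literature.NumberTheory.Automorphic.CuspidalAutomorphicRepData n F hF, π.1.IsLAlgebraic ∧ Literature.NumberTheory.Automorphic.IsWeakBaseChangeLiftAE π.1 P.1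 := by
  intro hdesc harch n F E _ _ _ _ _ _ hTR h2 hF hE P hPL hstab
  haveI : FiniteDimensional F E := Module.finite_of_finrank_eq_succ h2
  have hcyc : IsCyclic (E ≃ₐ[F] E) := isCyclic_algEquiv_of_finrank_eq_two h2
  have hprime : (Module.finrank F E).Prime := by rw [h2]; exact Nat.prime_two
  obtain ⟨π, hBC⟩ := hdesc n F E hF hE hcyc hprime P hstab
  exact ⟨π, harch.isLAlgebraic_descent' hcyc hprime hBC (exists_hasInfinityType_of_isTotallyReal π.1)
    hPL, hBC⟩

end Summit.Langlands.Langlands.Theorems.ReciprocityTRCM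

end
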